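import Literature.Analysis.FunctionSpaces.GaussianSchwartz
import Literature.Analysis.FunctionSpaces.LittlewoodPaleyHomogeneousProofs
import Mathlib.Analysis.Calculus.BumpFunction.InnerProduct
import HarnessLib

/-!
# Decay of the kernel of a homogeneous Fourier multiplier times a Gaussian

Analysis/Fourier support file (everything **proved**, no named facts). For a symbol
`τ ∈ C^∞(E ∖ {0})` on a finite-dimensional real inner product space `E` (`d = dim E`) which is
positively homogeneous of degree `k ∈ ℕ` (`τ(cξ) = cᵏ τ(ξ)` for `c > 0`, `ξ ≠ 0`, and `τ(0) = 0`)
and `a > 0`, the kernel `K = 𝓕⁻(τ e^{-a‖·‖²})` of the operator `τ(D) e^{(a/4π²)Δ}` satisfies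

  `|K(u)| (1 + ‖u‖)^{k + d} ≤ C`          (`exists_norm_fourierInv_homogeneous_mul_cgauss_le`).

This is the classical decay `|x|^{-d-k}` of the kernel of a symbol with a homogeneous singularity
of order `k` at the origin (Stein, *Harmonic Analysis* (1993), Ch. VI §4, Prop. 1 and §7.4), in the
form consumed by the parabolic theory of `σ(D) e^{tΔ}` (Lemarié-Rieusset 2016, Prop. 13.4 p. 465:
`|σ(D)W(x)| ≤ C(1+|x|)^{-4}`, `|∇σ(D)W| ≤ C(1+|x|)^{-5}`, `|ΔσW| ≤ C(1+|x|)^{-6}` for `σ`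
homogeneous of degree `1` on `ℝ³`, i.e. `k = 1, 2, 3`, `d = 3`), see
`Literature/Analysis/FluidPDE/MultiplierHeatPotentialHolder.lean`.

## The proof

For `‖u‖ ≤ 1` the bound is `‖τ e^{-a‖·‖²}‖_{L¹}`. For `R = ‖u‖ ≥ 1` split the symbol with the
smooth cutoff `χ₀(Rξ)` (`χ₀ = FunctionSpaces.dyadicCutoff E`, `= 1` on `‖η‖ ≤ 1`, `= 0` for `‖η‖ ≥ 2`):
* the low-frequency part `τ e^{-a‖·‖²} χ₀(R·)` is supported in `‖ξ‖ ≤ 2/R` and bounded by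
  `T₀ (2/R)ᵏ`, so its kernel is `≤ T₀ 2^{k+d} |B₁| R^{-(k+d)}` (`norm_fourierInv_lowSymbol_le`);
* the high-frequency part `b_R = τ e^{-a‖·‖²} (1 - χ₀(R·))` (`cutSymbol`) is smooth, and by the
  Leibniz rule on the open set `E ∖ {0}` with `‖Dʲτ(ξ)‖ ≤ Tⱼ ‖ξ‖^{k-j}` (homogeneity,
  `exists_norm_iteratedFDeriv_le_of_homogeneous`), the Faà di Bruno bound for the Gaussian
  (`norm_iteratedFDeriv_exp_neg_mul_norm_sq_le`) and `‖Dˡ(1 - χ₀(R·))(ξ)‖ ≤ Mₗ 2ˡ ‖ξ‖^{-l}`,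
  `‖Dⁿ b_R(ξ)‖ ≤ Bₙ (‖ξ‖^{k-n} + ‖ξ‖^{k+n}) e^{-a‖ξ‖²} 1_{‖ξ‖ ≥ 1/R}` uniformly in `R`
  (`exists_norm_iteratedFDeriv_cutSymbol_le`), whence `‖Dⁿ b_R‖_{L¹} ≤ Cₙ R` for `n ≤ k + d + 1`
  (`exists_integral_norm_iteratedFDeriv_cutSymbol_le`, the annulus integral
  `∫_{1/R ≤ ‖ξ‖ ≤ 1} ‖ξ‖^{-(d+1)} ≤ 2^{d+1}|B₁| R`, `lintegral_annulus_norm_rpow_neg_le`); Mathlib's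
  `N = k + d + 1`-fold integration by parts `‖u‖^N |𝓕 b(-u)| ≤ 2^N Σ_{n ≤ N} ‖Dⁿ b‖_{L¹}`
  (`Real.pow_mul_norm_iteratedFDeriv_fourier_le`) then gives `|𝓕⁻ b_R(u)| ≤ C R^{-(k+d)}`
  (`exists_norm_fourierInv_cutSymbol_le`).

## References

* E. M. Stein, *Harmonic Analysis: Real-Variable Methods, Orthogonality, and Oscillatory
  Integrals*, Princeton (1993), Ch. VI §4 (pseudo-differential operators: kernel estimates for
  symbols) and §7.4. [Stein1993]
* P. G. Lemarié-Rieusset, *The Navier–Stokes Problem in the 21st Century*, CRC Press (2016),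
  Prop. 13.4 and its proof, p. 465. [LemarieRieusset2016]
-/

noncomputable section

open MeasureTheory Filter Topology Function Set Metric Module
open scoped ENNReal NNReal FourierTransform Real ContDiff RealInnerProductSpace

namespace Literature.Analysis.Fourier

variable {E : Type*} [NormedAddCommGroup E]

/-! ### The complex Gaussian -/

/-- The complex Gaussian `ξ ↦ e^{-a‖ξ‖²}`. [folklore] -/
def cgauss (a : ℝ) (ξ : E) : ℂ := ((Real.exp (-a * ‖ξ‖ ^ 2) : ℝ) : ℂ)

/-- Unfolding of `cgauss`. [folklore] -/
theorem cgauss_eq (a : ℝ) : (cgauss a : E → ℂ) = fun x : E => ((Real.exp (-a * ‖x‖ ^ 2) : ℝ) : ℂ) := rfl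

/-- `|e^{-a‖ξ‖²}| = e^{-a‖ξ‖²}`. [folklore] -/
theorem norm_cgauss (a : ℝ) (ξ : E) : ‖cgauss a ξ‖ = Real.exp (-a * ‖ξ‖ ^ 2) := by
  rw [cgauss, Complex.norm_real, Real.norm_eq_abs, abs_of_pos (Real.exp_pos _)]

/-- `|e^{-a‖ξ‖²}| ≤ 1` for `a ≥ 0`. [folklore] -/
theorem norm_cgauss_le_one {a : ℝ} (ha : 0 ≤ a) (ξ : E) : ‖cgauss a ξ‖ ≤ 1 := by
  rw [norm_cgauss, Real.exp_le_one_iff]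
  nlinarith [sq_nonneg ‖ξ‖]

/-- The heat symbol as a complex Gaussian: `cgauss (4π²θ) = heatSymbol θ` (so that the kernel
`multiplierHeatKernel σ θ = 𝓕⁻ (σ · heatSymbol θ)` of `ParabolicHeatPotentials.lean` is
`𝓕⁻ (σ · cgauss (4π²θ))` without unfolding). [folklore] -/
theorem cgauss_heatSymbol (θ : ℝ) :
    (cgauss ((2 * π) ^ 2 * θ) : E → ℂ) = fun ξ : E => (UnboundedOperators.heatSymbol θ ξ : ℂ) := by
  funext ξ
  simp only [cgauss, UnboundedOperators.heatSymbol, neg_mul]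

variable [InnerProductSpace ℝ E]

/-- The complex Gaussian is smooth. [folklore] -/
theorem contDiff_cgauss (a : ℝ) {n : WithTop ℕ∞} : ContDiff ℝ n (cgauss a : E → ℂ) :=
  FunctionSpaces.contDiff_ofReal_exp_neg_mul_norm_sq a

/-- For `0 < a`, `cgauss a` is the Gaussian Schwartz function `gaussianSchwartz E a`
(`GaussianSchwartz.lean`) as a plain function. [folklore] -/
theorem cgauss_eq_coe_gaussianSchwartz {a : ℝ} (ha : 0 < a) :
    (cgauss a : E → ℂ) = ⇑(FunctionSpaces.gaussianSchwartz E a) := by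
  rw [FunctionSpaces.coe_gaussianSchwartz ha]; rfl

/-- `‖Dᵖ e^{-a‖·‖²}(ξ)‖ ≤ p! (max 1 a)ᵖ 2ᵖ (max ‖ξ‖ 1)ᵖ e^{-a‖ξ‖²}`. [folklore] -/
theorem norm_iteratedFDeriv_cgauss_le {a : ℝ} (ha : 0 ≤ a) (p : ℕ) (ξ : E) :
    ‖iteratedFDeriv ℝ p (cgauss a : E → ℂ) ξ‖ ≤
      (p.factorial * (max 1 a) ^ p * 2 ^ p) * (max ‖ξ‖ 1) ^ p * Real.exp (-a * ‖ξ‖ ^ 2) := by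
  rw [cgauss_eq, FunctionSpaces.norm_iteratedFDeriv_ofReal_exp_neg_mul_norm_sq]
  refine (FunctionSpaces.norm_iteratedFDeriv_exp_neg_mul_norm_sq_le ha p ξ).trans (le_of_eq ?_)
  have : max (2 * ‖ξ‖) 2 = 2 * max ‖ξ‖ 1 := by
    rcases le_total ‖ξ‖ 1 with h | h
    · rw [max_eq_right h, max_eq_right (by linarith)]; ring
    · rw [max_eq_left h, max_eq_left (by linarith)]
  rw [this, mul_pow]; ring

/-! ### Homogeneous symbols -/

/-- Derivative bounds of a positively homogeneous symbol of natural degree `k` (from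
`exists_norm_iteratedFDeriv_le_of_homogeneous`). [folklore] -/
theorem exists_norm_iteratedFDeriv_homogeneous_le [FiniteDimensional ℝ E] {τ : E → ℂ} {k : ℕ}
    (hτ : ContDiffOn ℝ ∞ τ {0}ᶜ)
    (hhom : ∀ c : ℝ, 0 < c → ∀ ξ : E, ξ ≠ 0 → τ (c • ξ) = (c : ℂ) ^ k * τ ξ) (j : ℕ) :
    ∃ T : ℝ, 0 ≤ T ∧ ∀ ξ : E, ξ ≠ 0 → ‖iteratedFDeriv ℝ j τ ξ‖ ≤ T * ‖ξ‖ ^ ((k : ℝ) - j) := by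
  have hhom' : ∀ c : ℝ, 0 < c → ∀ ξ : E, ξ ≠ 0 → τ (c • ξ) = ((c ^ (k : ℝ) : ℝ) : ℂ) * τ ξ := by
    intro c hc ξ hξ
    rw [hhom c hc ξ hξ, Real.rpow_natCast]
    push_cast
    rfl
  obtain ⟨C, hC⟩ := FunctionSpaces.exists_norm_iteratedFDeriv_le_of_homogeneous hτ hhom' j
  refine ⟨max C 0, le_max_right _ _, fun ξ hξ => (hC ξ hξ).trans ?_⟩
  gcongr
  exact le_max_left _ _

/-- Order zero of the homogeneous bounds: `‖τ(ξ)‖ ≤ T₀ ‖ξ‖ᵏ` for `ξ ≠ 0`. [folklore] -/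
theorem norm_homogeneous_le {τ : E → ℂ} {k : ℕ} {T : ℝ}
    (hT : ∀ ξ : E, ξ ≠ 0 → ‖iteratedFDeriv ℝ 0 τ ξ‖ ≤ T * ‖ξ‖ ^ ((k : ℝ) - (0 : ℕ))) {ξ : E}
    (hξ : ξ ≠ 0) : ‖τ ξ‖ ≤ T * ‖ξ‖ ^ k := by
  have := hT ξ hξ
  rwa [norm_iteratedFDeriv_zero, Nat.cast_zero, sub_zero, Real.rpow_natCast] at this


/-! ### The smooth frequency cutoff -/

/-- The high-frequency cutoff at scale `1/R`: `ψ_R(ξ) = 1 - χ₀(R ξ)` (complex-valued), where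
`χ₀ = Literature.Analysis.FunctionSpaces.dyadicCutoff E` is the canonical Littlewood–Paley bump
(`= 1` on `‖η‖ ≤ 1`, `= 0` for `‖η‖ ≥ 2`, values in `[0, 1]`). [folklore] -/
def highCutoff (R : ℝ) (ξ : E) : ℂ := (((1 : ℝ) - (FunctionSpaces.dyadicCutoff E) (R • ξ) : ℝ) : ℂ)

/-- `ψ_R = 1 - (χ₀ ∘ (R•))` as complex-valued functions. [folklore] -/
theorem highCutoff_eq (R : ℝ) :
    (highCutoff R : E → ℂ) = fun ξ => (1 : ℂ) - (Complex.ofRealCLM ∘ (fun ξ : E => (FunctionSpaces.dyadicCutoff E) (R • ξ))) ξ := by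
  ext ξ; simp [highCutoff]

/-- `χ₀(R·)` is smooth. [folklore] -/
theorem contDiff_dyadicCutoff_comp_smul (R : ℝ) {n : ℕ∞} :
    ContDiff ℝ n (fun ξ : E => (FunctionSpaces.dyadicCutoff E) (R • ξ)) :=
  (FunctionSpaces.dyadicCutoff E).contDiff.comp (contDiff_const_smul R)

/-- `ψ_R` is smooth. [folklore] -/
theorem contDiff_highCutoff (R : ℝ) {n : ℕ∞} : ContDiff ℝ n (highCutoff R : E → ℂ) := by
  rw [highCutoff_eq]
  exact contDiff_const.sub (Complex.ofRealCLM.contDiff.comp (contDiff_dyadicCutoff_comp_smul R))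

/-- `|ψ_R| ≤ 1`. [folklore] -/
theorem norm_highCutoff_le_one (R : ℝ) (ξ : E) : ‖highCutoff R ξ‖ ≤ 1 := by
  rw [highCutoff, Complex.norm_real, Real.norm_eq_abs, abs_le]
  have h0 := (FunctionSpaces.dyadicCutoff E).nonneg (x := R • ξ)
  have h1 := (FunctionSpaces.dyadicCutoff E).le_one (x := R • ξ)
  constructor <;> linarith

/-- `|1 - ψ_R| = χ₀(R·) ≤ 1`. [folklore] -/
theorem norm_one_sub_highCutoff_le_one (R : ℝ) (ξ : E) : ‖1 - highCutoff R ξ‖ ≤ 1 := by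
  have h0 := (FunctionSpaces.dyadicCutoff E).nonneg (x := R • ξ)
  have h1 := (FunctionSpaces.dyadicCutoff E).le_one (x := R • ξ)
  have : (1 : ℂ) - highCutoff R ξ = (((FunctionSpaces.dyadicCutoff E) (R • ξ) : ℝ) : ℂ) := by
    simp [highCutoff]
  rw [this, Complex.norm_real, Real.norm_eq_abs, abs_of_nonneg h0]
  exact h1

/-- `ψ_R(ξ) = 0` for `‖Rξ‖ ≤ 1`. [folklore] -/
theorem highCutoff_of_norm_le {R : ℝ} {ξ : E} (h : ‖R • ξ‖ ≤ 1) : highCutoff R ξ = 0 := by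
  simp [highCutoff, FunctionSpaces.dyadicCutoff_apply_of_norm_le_one h]

/-- `ψ_R(ξ) = 1` for `‖Rξ‖ ≥ 2`. [folklore] -/
theorem highCutoff_of_le_norm {R : ℝ} {ξ : E} (h : 2 ≤ ‖R • ξ‖) : highCutoff R ξ = 1 := by
  simp [highCutoff, FunctionSpaces.dyadicCutoff_apply_of_two_le_norm h]

/-- The derivatives of order `l ≥ 1` of `ψ_R` vanish where `‖Rξ‖ > 2`. [folklore] -/
theorem iteratedFDeriv_highCutoff_eq_zero {R : ℝ} {l : ℕ} (hl : 1 ≤ l) {ξ : E} (h : 2 < ‖R • ξ‖) :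
    iteratedFDeriv ℝ l (highCutoff R : E → ℂ) ξ = 0 := by
  have hev : (highCutoff R : E → ℂ) =ᶠ[𝓝 ξ] fun _ => (1 : ℂ) := by
    have ho : IsOpen {η : E | 2 < ‖R • η‖} := isOpen_lt continuous_const (continuous_const_smul R).norm
    filter_upwards [ho.mem_nhds h] with η hη
    exact highCutoff_of_le_norm (le_of_lt hη)
  rw [(hev.iteratedFDeriv ℝ l).eq_of_nhds, iteratedFDeriv_const_of_ne (by omega : l ≠ 0), Pi.zero_apply]

variable [FiniteDimensional ℝ E]

/-- The derivatives of the fixed bump are bounded. [folklore] -/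
theorem exists_norm_iteratedFDeriv_dyadicCutoff_le (l : ℕ) :
    ∃ M : ℝ, 0 ≤ M ∧ ∀ x : E, ‖iteratedFDeriv ℝ l (fun x : E => (FunctionSpaces.dyadicCutoff E) x) x‖ ≤ M := by
  have hc : Continuous (iteratedFDeriv ℝ l (fun x : E => (FunctionSpaces.dyadicCutoff E) x)) :=
    (FunctionSpaces.dyadicCutoff E).contDiff.continuous_iteratedFDeriv (mod_cast le_top)
  have hs : HasCompactSupport (iteratedFDeriv ℝ l (fun x : E => (FunctionSpaces.dyadicCutoff E) x)) :=
    (FunctionSpaces.dyadicCutoff E).hasCompactSupport.iteratedFDeriv l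
  obtain ⟨M, hM⟩ := hc.bounded_above_of_compact_support hs
  exact ⟨max M 0, le_max_right _ _, fun x => (hM x).trans (le_max_left _ _)⟩

/-- Derivatives of order `l ≥ 1` of the cutoff: `‖D^l ψ_R(ξ)‖ ≤ R^l ‖D^l χ₀(Rξ)‖`. [folklore] -/
theorem norm_iteratedFDeriv_highCutoff_le {R : ℝ} (hR : 0 < R) {l : ℕ} (hl : 1 ≤ l) (ξ : E) :
    ‖iteratedFDeriv ℝ l (highCutoff R : E → ℂ) ξ‖ ≤
      R ^ l * ‖iteratedFDeriv ℝ l (fun x : E => (FunctionSpaces.dyadicCutoff E) x) (R • ξ)‖ := by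
  rw [highCutoff_eq]
  have h1 : ContDiff ℝ ∞ (fun _ : E => (1 : ℂ)) := contDiff_const
  have h2 : ContDiff ℝ ∞ (Complex.ofRealCLM ∘ (fun ξ : E => (FunctionSpaces.dyadicCutoff E) (R • ξ))) :=
    Complex.ofRealCLM.contDiff.comp (contDiff_dyadicCutoff_comp_smul R)
  rw [show (fun ξ : E => (1 : ℂ) - (Complex.ofRealCLM ∘ (fun ξ : E => (FunctionSpaces.dyadicCutoff E) (R • ξ))) ξ)
      = (fun _ : E => (1 : ℂ)) - (Complex.ofRealCLM ∘ (fun ξ : E => (FunctionSpaces.dyadicCutoff E) (R • ξ))) from rfl]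
  rw [iteratedFDeriv_sub (h1.of_le (by exact_mod_cast le_top)) (h2.of_le (by exact_mod_cast le_top))]
  simp only [Pi.sub_apply]
  rw [iteratedFDeriv_const_of_ne (by omega : l ≠ 0), Pi.zero_apply, zero_sub, norm_neg]
  -- remove the isometry `ℝ → ℂ`
  have h3 : ‖iteratedFDeriv ℝ l (Complex.ofRealCLM ∘ (fun ξ : E => (FunctionSpaces.dyadicCutoff E) (R • ξ))) ξ‖
      = ‖iteratedFDeriv ℝ l (fun ξ : E => (FunctionSpaces.dyadicCutoff E) (R • ξ)) ξ‖ :=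
    Complex.ofRealLI.norm_iteratedFDeriv_comp_left ((contDiff_dyadicCutoff_comp_smul R (n := (⊤ : ℕ∞))).contDiffAt) (mod_cast le_top)
  rw [h3]
  -- chain rule for the dilation
  have h4 : (fun ξ : E => (FunctionSpaces.dyadicCutoff E) (R • ξ))
      = (fun x : E => (FunctionSpaces.dyadicCutoff E) x) ∘ (R • ContinuousLinearMap.id ℝ E) := by
    ext ξ; simp
  rw [h4, ContinuousLinearMap.iteratedFDeriv_comp_right _ (FunctionSpaces.dyadicCutoff E).contDiff _ (mod_cast le_top)]
  refine (ContinuousMultilinearMap.norm_compContinuousLinearMap_le _ _).trans ?_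
  simp only [FunLike.coe_smul, Pi.smul_apply, ContinuousLinearMap.coe_id', id_eq, Finset.prod_const, Finset.card_univ, Fintype.card_fin]
  rw [mul_comm]
  gcongr
  refine (ContinuousLinearMap.opNorm_smul_le _ _).trans ?_
  rw [Real.norm_eq_abs, abs_of_pos hR]
  exact mul_le_of_le_one_right hR.le ContinuousLinearMap.norm_id_le

/-- **Uniform bound**: `‖D^l ψ_R(ξ)‖ ≤ M_l 2^l ‖ξ‖^{-l}` for `ξ ≠ 0`, `R > 0`, all `l`. [folklore] -/
theorem exists_norm_iteratedFDeriv_highCutoff_le (l : ℕ) :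
    ∃ M : ℝ, 0 ≤ M ∧ ∀ R : ℝ, 0 < R → ∀ ξ : E, ξ ≠ 0 →
      ‖iteratedFDeriv ℝ l (highCutoff R : E → ℂ) ξ‖ ≤ M * ‖ξ‖ ^ (-(l : ℝ)) := by
  rcases Nat.eq_zero_or_pos l with rfl | hl
  · refine ⟨1, zero_le_one, fun R hR ξ hξ => ?_⟩
    rw [norm_iteratedFDeriv_zero, Nat.cast_zero, neg_zero, Real.rpow_zero, mul_one]
    exact norm_highCutoff_le_one R ξ
  obtain ⟨M, hM0, hM⟩ := exists_norm_iteratedFDeriv_dyadicCutoff_le (E := E) l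
  refine ⟨M * 2 ^ l, by positivity, fun R hR ξ hξ => ?_⟩
  have hξ0 : 0 < ‖ξ‖ := norm_pos_iff.2 hξ
  rcases lt_or_ge 2 ‖R • ξ‖ with h2 | h2
  · rw [iteratedFDeriv_highCutoff_eq_zero hl h2, norm_zero]
    positivity
  · have hRle : R ≤ 2 * ‖ξ‖⁻¹ := by
      rw [norm_smul, Real.norm_eq_abs, abs_of_pos hR] at h2
      rw [← div_eq_mul_inv, le_div_iff₀ hξ0]
      exact h2
    calc ‖iteratedFDeriv ℝ l (highCutoff R : E → ℂ) ξ‖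
        ≤ R ^ l * ‖iteratedFDeriv ℝ l (fun x : E => (FunctionSpaces.dyadicCutoff E) x) (R • ξ)‖ :=
          norm_iteratedFDeriv_highCutoff_le hR hl ξ
      _ ≤ (2 * ‖ξ‖⁻¹) ^ l * M := by gcongr; exact hM _
      _ = M * 2 ^ l * ‖ξ‖ ^ (-(l : ℝ)) := by
          rw [mul_pow, Real.rpow_neg hξ0.le, Real.rpow_natCast, inv_pow]; ring


/-! ### The cut symbol `b_R = τ · e^{-a‖·‖²} · ψ_R` -/

/-- The high-frequency part of the symbol: `b_R(ξ) = τ(ξ) e^{-a‖ξ‖²} (1 - χ₀(Rξ))`. [folklore] -/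
def cutSymbol (τ : E → ℂ) (a R : ℝ) (ξ : E) : ℂ := τ ξ * cgauss a ξ * highCutoff R ξ

omit [FiniteDimensional ℝ E] in
/-- `b_R` vanishes near every `ξ` with `‖Rξ‖ < 1`. [folklore] -/
theorem cutSymbol_eventuallyEq_zero (τ : E → ℂ) (a : ℝ) {R : ℝ} {ξ : E} (h : ‖R • ξ‖ < 1) :
    (cutSymbol τ a R : E → ℂ) =ᶠ[𝓝 ξ] fun _ => 0 := by
  have ho : IsOpen {η : E | ‖R • η‖ < 1} := isOpen_lt (continuous_const_smul R).norm continuous_const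
  filter_upwards [ho.mem_nhds h] with η hη
  simp [cutSymbol, highCutoff_of_norm_le (le_of_lt hη)]

omit [FiniteDimensional ℝ E] in
/-- All derivatives of `b_R` vanish where `‖Rξ‖ < 1`. [folklore] -/
theorem iteratedFDeriv_cutSymbol_eq_zero (τ : E → ℂ) (a : ℝ) {R : ℝ} {ξ : E} (h : ‖R • ξ‖ < 1) (n : ℕ) :
    iteratedFDeriv ℝ n (cutSymbol τ a R) ξ = 0 := by
  rw [((cutSymbol_eventuallyEq_zero τ a h).iteratedFDeriv ℝ n).eq_of_nhds, iteratedFDeriv_fun_zero]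
  rfl

omit [FiniteDimensional ℝ E] in
/-- `b_R` is smooth on all of `E` (it vanishes near the origin, where `τ` may be singular). [folklore] -/
theorem contDiff_cutSymbol {τ : E → ℂ} (hτ : ContDiffOn ℝ ∞ τ {0}ᶜ) (a R : ℝ) :
    ContDiff ℝ ∞ (cutSymbol τ a R) := by
  refine contDiff_iff_contDiffAt.2 fun ξ => ?_
  by_cases h : ‖R • ξ‖ < 1
  · exact (contDiffAt_const (c := (0 : ℂ))).congr_of_eventuallyEq (cutSymbol_eventuallyEq_zero τ a h)
  · have hξ : ξ ≠ 0 := by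
      rintro rfl
      exact h (by simp)
    have h1 : ContDiffAt ℝ ∞ τ ξ := hτ.contDiffAt (isOpen_compl_singleton.mem_nhds hξ)
    exact (h1.mul (contDiff_cgauss a).contDiffAt).mul (contDiff_highCutoff R).contDiffAt

/-- **Pointwise Leibniz bound for the cut symbol.** For `τ ∈ C^∞(E ∖ {0})` positively homogeneous
of degree `k` and `0 ≤ a`, for every `n` there is `B` such that for all `R > 0` and `ξ ≠ 0`,
`‖Dⁿ b_R(ξ)‖ ≤ B (‖ξ‖^{k-n} + ‖ξ‖^{k+n}) e^{-a‖ξ‖²}`. [folklore] -/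
theorem exists_norm_iteratedFDeriv_cutSymbol_le {τ : E → ℂ} {k : ℕ} (hτ : ContDiffOn ℝ ∞ τ {0}ᶜ)
    (hhom : ∀ c : ℝ, 0 < c → ∀ ξ : E, ξ ≠ 0 → τ (c • ξ) = (c : ℂ) ^ k * τ ξ) {a : ℝ} (ha : 0 ≤ a)
    (n : ℕ) :
    ∃ B : ℝ, 0 ≤ B ∧ ∀ R : ℝ, 0 < R → ∀ ξ : E, ξ ≠ 0 →
      ‖iteratedFDeriv ℝ n (cutSymbol τ a R) ξ‖ ≤
        B * ((‖ξ‖ ^ ((k : ℝ) - n) + ‖ξ‖ ^ (k + n)) * Real.exp (-a * ‖ξ‖ ^ 2)) := by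
  -- constants
  have hTex := fun j => exists_norm_iteratedFDeriv_homogeneous_le hτ hhom j
  choose T hT0 hT using hTex
  have hMex := fun l => exists_norm_iteratedFDeriv_highCutoff_le (E := E) l
  choose M hM0 hM using hMex
  set c : ℕ → ℝ := fun p => p.factorial * (max 1 a) ^ p * 2 ^ p with hc
  have hc0 : ∀ p, 0 ≤ c p := fun p => by positivity
  set B : ℝ := ∑ i ∈ Finset.range (n + 1), (n.choose i : ℝ) *
    ∑ j ∈ Finset.range (i + 1), (i.choose j : ℝ) * T j * c (i - j) * M (n - i) with hB
  have hB0 : 0 ≤ B := by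
    refine Finset.sum_nonneg fun i _ => mul_nonneg (by positivity) (Finset.sum_nonneg fun j _ => ?_)
    have := hT0 j; have := hM0 (n - i); have := hc0 (i - j)
    positivity
  refine ⟨B, hB0, fun R hR ξ hξ => ?_⟩
  set U : Set E := {0}ᶜ with hU
  have hUo : IsOpen U := isOpen_compl_singleton
  have hUu : UniqueDiffOn ℝ U := hUo.uniqueDiffOn
  have hξU : ξ ∈ U := hξ
  set t : ℝ := ‖ξ‖ with ht
  have ht0 : 0 < t := norm_pos_iff.2 hξ
  set Y : ℝ := (t ^ ((k : ℝ) - n) + t ^ (k + n)) * Real.exp (-a * t ^ 2) with hY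
  have hY0 : 0 ≤ Y := by positivity
  -- the key scalar inequality
  have hKS : ∀ i j : ℕ, j ≤ i → i ≤ n →
      t ^ ((k : ℝ) - j) * (max t 1) ^ (i - j) * t ^ (-((n - i : ℕ) : ℝ)) ≤ t ^ ((k : ℝ) - n) + t ^ (k + n) := by
    intro i j hji hin
    rcases le_total t 1 with h1 | h1
    · rw [max_eq_right h1, one_pow, mul_one, ← Real.rpow_add ht0]
      refine le_add_of_le_of_nonneg (Real.rpow_le_rpow_of_exponent_ge ht0 h1 ?_) (by positivity)
      push_cast [Nat.cast_sub hin]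
      linarith [(Nat.cast_le (α := ℝ)).2 hji]
    · rw [max_eq_left h1, ← Real.rpow_natCast t (i - j), ← Real.rpow_add ht0, ← Real.rpow_add ht0]
      refine le_add_of_nonneg_of_le (by positivity) ?_
      rw [← Real.rpow_natCast t (k + n)]
      refine Real.rpow_le_rpow_of_exponent_le h1 ?_
      push_cast [Nat.cast_sub hin, Nat.cast_sub hji]
      linarith [(Nat.cast_le (α := ℝ)).2 hji, (Nat.cast_le (α := ℝ)).2 hin, (Nat.cast_nonneg j : (0:ℝ) ≤ j)]
  -- smoothness on `U`
  have hτG : ContDiffOn ℝ ∞ (fun y => τ y * cgauss a y) U := hτ.mul (contDiff_cgauss a).contDiffOn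
  have hψ : ContDiffOn ℝ ∞ (highCutoff R : E → ℂ) U := (contDiff_highCutoff R).contDiffOn
  -- outer Leibniz
  have hout := norm_iteratedFDerivWithin_mul_le (n := n) hτG hψ hUu hξU (mod_cast le_top)
  have heq : iteratedFDeriv ℝ n (cutSymbol τ a R) ξ =
      iteratedFDerivWithin ℝ n (fun y => τ y * cgauss a y * highCutoff R y) U ξ := by
    rw [← iteratedFDerivWithin_of_isOpen n hUo hξU]; rfl
  rw [heq]
  refine hout.trans ?_
  -- termwise
  have hterm : ∀ i ∈ Finset.range (n + 1),
      (n.choose i : ℝ) * ‖iteratedFDerivWithin ℝ i (fun y => τ y * cgauss a y) U ξ‖ *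
        ‖iteratedFDerivWithin ℝ (n - i) (highCutoff R : E → ℂ) U ξ‖ ≤
      (n.choose i : ℝ) * ∑ j ∈ Finset.range (i + 1), (i.choose j : ℝ) * T j * c (i - j) * M (n - i) * Y := by
    intro i hi
    have hin : i ≤ n := Nat.lt_succ_iff.1 (Finset.mem_range.1 hi)
    rw [mul_assoc]
    refine mul_le_mul_of_nonneg_left ?_ (by positivity)
    -- inner Leibniz
    have hinn := norm_iteratedFDerivWithin_mul_le (n := i) hτ (contDiff_cgauss a).contDiffOn hUu hξU
      (mod_cast le_top)
    have hψb : ‖iteratedFDerivWithin ℝ (n - i) (highCutoff R : E → ℂ) U ξ‖ ≤ M (n - i) * t ^ (-((n - i : ℕ) : ℝ)) := by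
      rw [iteratedFDerivWithin_of_isOpen (n - i) hUo hξU]
      exact hM (n - i) R hR ξ hξ
    calc ‖iteratedFDerivWithin ℝ i (fun y => τ y * cgauss a y) U ξ‖ *
          ‖iteratedFDerivWithin ℝ (n - i) (highCutoff R : E → ℂ) U ξ‖
        ≤ (∑ j ∈ Finset.range (i + 1), (i.choose j : ℝ) * ‖iteratedFDerivWithin ℝ j τ U ξ‖ *
            ‖iteratedFDerivWithin ℝ (i - j) (cgauss a : E → ℂ) U ξ‖) * (M (n - i) * t ^ (-((n - i : ℕ) : ℝ))) :=
          mul_le_mul hinn hψb (norm_nonneg _) (Finset.sum_nonneg fun j _ => by positivity)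
      _ = ∑ j ∈ Finset.range (i + 1), (i.choose j : ℝ) * ‖iteratedFDerivWithin ℝ j τ U ξ‖ *
            ‖iteratedFDerivWithin ℝ (i - j) (cgauss a : E → ℂ) U ξ‖ * (M (n - i) * t ^ (-((n - i : ℕ) : ℝ))) := by
          rw [Finset.sum_mul]
      _ ≤ ∑ j ∈ Finset.range (i + 1), (i.choose j : ℝ) * T j * c (i - j) * M (n - i) * Y := by
          refine Finset.sum_le_sum fun j hj => ?_
          have hji : j ≤ i := Nat.lt_succ_iff.1 (Finset.mem_range.1 hj)
          have h1 : ‖iteratedFDerivWithin ℝ j τ U ξ‖ ≤ T j * t ^ ((k : ℝ) - j) := by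
            rw [iteratedFDerivWithin_of_isOpen j hUo hξU]; exact hT j ξ hξ
          have h2 : ‖iteratedFDerivWithin ℝ (i - j) (cgauss a : E → ℂ) U ξ‖ ≤
              c (i - j) * (max t 1) ^ (i - j) * Real.exp (-a * t ^ 2) := by
            rw [iteratedFDerivWithin_of_isOpen (i - j) hUo hξU]; exact norm_iteratedFDeriv_cgauss_le ha _ ξ
          calc (i.choose j : ℝ) * ‖iteratedFDerivWithin ℝ j τ U ξ‖ *
                ‖iteratedFDerivWithin ℝ (i - j) (cgauss a : E → ℂ) U ξ‖ * (M (n - i) * t ^ (-((n - i : ℕ) : ℝ)))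
              ≤ (i.choose j : ℝ) * (T j * t ^ ((k : ℝ) - j)) *
                (c (i - j) * (max t 1) ^ (i - j) * Real.exp (-a * t ^ 2)) * (M (n - i) * t ^ (-((n - i : ℕ) : ℝ))) := by
                have := hM0 (n - i); have := hT0 j; have := hc0 (i - j)
                gcongr
            _ = (i.choose j : ℝ) * T j * c (i - j) * M (n - i) *
                ((t ^ ((k : ℝ) - j) * (max t 1) ^ (i - j) * t ^ (-((n - i : ℕ) : ℝ))) * Real.exp (-a * t ^ 2)) := by ring
            _ ≤ (i.choose j : ℝ) * T j * c (i - j) * M (n - i) * Y := by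
                have := hT0 j; have := hM0 (n - i); have := hc0 (i - j)
                rw [hY]
                gcongr
                exact hKS i j hji hin
  calc ∑ i ∈ Finset.range (n + 1), (n.choose i : ℝ) * ‖iteratedFDerivWithin ℝ i (fun y => τ y * cgauss a y) U ξ‖ *
        ‖iteratedFDerivWithin ℝ (n - i) (highCutoff R : E → ℂ) U ξ‖
      ≤ ∑ i ∈ Finset.range (n + 1), (n.choose i : ℝ) *
          ∑ j ∈ Finset.range (i + 1), (i.choose j : ℝ) * T j * c (i - j) * M (n - i) * Y := Finset.sum_le_sum hterm
    _ = B * Y := by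
        rw [hB, Finset.sum_mul]
        refine Finset.sum_congr rfl fun i _ => ?_
        rw [mul_assoc, Finset.sum_mul]


/-! ### `L¹` bounds of the derivatives of the cut symbol -/

section L1

variable [MeasurableSpace E] [BorelSpace E]

/-- **The annulus integral** `∫_{r ≤ ‖ξ‖ ≤ 1} ‖ξ‖^{-(d+1)} dξ ≤ 2^{d+1} |B₁| / r` (`d = dim E`,
`0 < r`): dyadic shells `r2ⁱ ≤ ‖ξ‖ < r2ⁱ⁺¹`, on which the integrand is `≤ (r2ⁱ)^{-(d+1)}` and whose
volume is `≤ (r2ⁱ⁺¹)^d |B₁|`. [folklore] -/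
theorem lintegral_annulus_norm_rpow_neg_le {r : ℝ} (hr : 0 < r) :
    ∫⁻ ξ in {ξ : E | r ≤ ‖ξ‖ ∧ ‖ξ‖ ≤ 1}, ENNReal.ofReal (‖ξ‖ ^ (-((finrank ℝ E : ℝ) + 1))) ≤
      ENNReal.ofReal (2 ^ (finrank ℝ E + 1) * (volume (ball (0 : E) 1)).toReal / r) := by
  set d : ℕ := finrank ℝ E with hd
  set V : ℝ := (volume (ball (0 : E) 1)).toReal with hV
  have hV0 : 0 ≤ V := ENNReal.toReal_nonneg
  have hVfin : volume (ball (0 : E) 1) ≠ ⊤ := measure_ball_lt_top.ne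
  -- shells
  set S : ℕ → Set E := fun i => {ξ : E | r * 2 ^ i ≤ ‖ξ‖ ∧ ‖ξ‖ < r * 2 ^ (i + 1)} with hS
  have hcover : {ξ : E | r ≤ ‖ξ‖ ∧ ‖ξ‖ ≤ 1} ⊆ ⋃ i, S i := by
    intro ξ hξ
    have h1 : 1 ≤ ‖ξ‖ / r := by rw [le_div_iff₀ hr, one_mul]; exact hξ.1
    obtain ⟨i, hi1, hi2⟩ := exists_nat_pow_near h1 one_lt_two
    refine mem_iUnion.2 ⟨i, ?_, ?_⟩
    · have := (le_div_iff₀ hr).1 hi1; simpa [mul_comm] using this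
    · have := (div_lt_iff₀ hr).1 hi2; simpa [mul_comm] using this
  have hSmeas : ∀ i, MeasurableSet (S i) := fun i =>
    (measurableSet_le measurable_const measurable_norm).inter (measurableSet_lt measurable_norm measurable_const)
  -- bound on each shell
  have hshell : ∀ i : ℕ, ∫⁻ ξ in S i, ENNReal.ofReal (‖ξ‖ ^ (-((d : ℝ) + 1))) ≤
      ENNReal.ofReal (2 ^ d * V / r * (2⁻¹) ^ i) := by
    intro i
    have hri : 0 < r * 2 ^ i := by positivity
    calc ∫⁻ ξ in S i, ENNReal.ofReal (‖ξ‖ ^ (-((d : ℝ) + 1)))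
        ≤ ∫⁻ _ in S i, ENNReal.ofReal ((r * 2 ^ i) ^ (-((d : ℝ) + 1))) := by
          refine setLIntegral_mono measurable_const fun ξ hξ => ?_
          exact ENNReal.ofReal_le_ofReal (Real.rpow_le_rpow_of_nonpos hri hξ.1 (neg_nonpos.2 (by positivity)))
      _ = ENNReal.ofReal ((r * 2 ^ i) ^ (-((d : ℝ) + 1))) * volume (S i) := setLIntegral_const _ _
      _ ≤ ENNReal.ofReal ((r * 2 ^ i) ^ (-((d : ℝ) + 1))) * volume (ball (0 : E) (r * 2 ^ (i + 1))) := by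
          gcongr
          intro ξ hξ
          rw [mem_ball_zero_iff]; exact hξ.2
      _ = ENNReal.ofReal ((r * 2 ^ i) ^ (-((d : ℝ) + 1))) *
            (ENNReal.ofReal ((r * 2 ^ (i + 1)) ^ d) * volume (ball (0 : E) 1)) := by
          rw [Measure.addHaar_ball_of_pos _ _ (by positivity)]
      _ = ENNReal.ofReal ((r * 2 ^ i) ^ (-((d : ℝ) + 1)) * (r * 2 ^ (i + 1)) ^ d * V) := by
          rw [hV, ENNReal.ofReal_mul (by positivity), ENNReal.ofReal_mul (by positivity),
            ENNReal.ofReal_toReal hVfin, mul_assoc]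
      _ = ENNReal.ofReal (2 ^ d * V / r * (2⁻¹) ^ i) := by
          congr 1
          rw [Real.rpow_neg hri.le, Real.rpow_add hri, Real.rpow_natCast, Real.rpow_one, inv_pow]
          field_simp
          ring
  calc ∫⁻ ξ in {ξ : E | r ≤ ‖ξ‖ ∧ ‖ξ‖ ≤ 1}, ENNReal.ofReal (‖ξ‖ ^ (-((d : ℝ) + 1)))
      ≤ ∫⁻ ξ in ⋃ i, S i, ENNReal.ofReal (‖ξ‖ ^ (-((d : ℝ) + 1))) := lintegral_mono_set hcover
    _ ≤ ∑' i, ∫⁻ ξ in S i, ENNReal.ofReal (‖ξ‖ ^ (-((d : ℝ) + 1))) := lintegral_iUnion_le _ _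
    _ ≤ ∑' i : ℕ, ENNReal.ofReal (2 ^ d * V / r * (2⁻¹) ^ i) := ENNReal.tsum_le_tsum hshell
    _ = ENNReal.ofReal (∑' i : ℕ, 2 ^ d * V / r * (2⁻¹) ^ i) := by
        rw [ENNReal.ofReal_tsum_of_nonneg (fun i => by positivity)]
        exact (summable_geometric_of_lt_one (by norm_num) (by norm_num)).mul_left _
    _ = ENNReal.ofReal (2 ^ (d + 1) * V / r) := by
        rw [tsum_mul_left, tsum_geometric_of_lt_one (by norm_num) (by norm_num)]
        congr 1
        ring

/-- Gaussian moments are finite: `ξ ↦ ‖ξ‖ᵖ e^{-a‖ξ‖²}` is integrable for `0 < a`. [folklore] -/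
theorem integrable_norm_pow_mul_exp_neg_mul_norm_sq {a : ℝ} (ha : 0 < a) (p : ℕ) :
    Integrable (fun ξ : E => ‖ξ‖ ^ p * Real.exp (-a * ‖ξ‖ ^ 2)) := by
  have h := (FunctionSpaces.realGaussianSchwartz E a).integrable_pow_mul volume p
  refine h.congr (Eventually.of_forall fun ξ => ?_)
  simp only [FunctionSpaces.realGaussianSchwartz_apply ha, Real.norm_eq_abs, abs_of_pos (Real.exp_pos _)]


/-- **`L¹` bound**: for `n ≤ k + d + 1` and `R ≥ 1`, `Dⁿ b_R` is integrable with
`∫ ‖Dⁿ b_R‖ ≤ C R`. [folklore] -/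
theorem exists_integral_norm_iteratedFDeriv_cutSymbol_le {τ : E → ℂ} {k : ℕ}
    (hτ : ContDiffOn ℝ ∞ τ {0}ᶜ)
    (hhom : ∀ c : ℝ, 0 < c → ∀ ξ : E, ξ ≠ 0 → τ (c • ξ) = (c : ℂ) ^ k * τ ξ) {a : ℝ} (ha : 0 < a)
    {n : ℕ} (hn : n ≤ k + finrank ℝ E + 1) :
    ∃ C : ℝ, 0 ≤ C ∧ ∀ R : ℝ, 1 ≤ R → Integrable (iteratedFDeriv ℝ n (cutSymbol τ a R)) ∧
      ∫ ξ, ‖iteratedFDeriv ℝ n (cutSymbol τ a R) ξ‖ ≤ C * R := by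
  obtain ⟨B, hB0, hB⟩ := exists_norm_iteratedFDeriv_cutSymbol_le hτ hhom ha.le n
  set d : ℕ := finrank ℝ E with hd
  set V : ℝ := (volume (ball (0 : E) 1)).toReal with hV
  have hV0 : 0 ≤ V := ENNReal.toReal_nonneg
  set CE : ℝ := 2 ^ (d + 1) * V with hCE
  set I : ℝ := ∫ ξ : E, ‖ξ‖ ^ (k + n) * Real.exp (-a * ‖ξ‖ ^ 2) with hI
  have hI0 : 0 ≤ I := integral_nonneg fun ξ => by positivity
  have hIint : Integrable (fun ξ : E => ‖ξ‖ ^ (k + n) * Real.exp (-a * ‖ξ‖ ^ 2)) :=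
    integrable_norm_pow_mul_exp_neg_mul_norm_sq ha (k + n)
  refine ⟨B * (CE + 2 * I), by positivity, fun R hR => ?_⟩
  have hR0 : 0 < R := one_pos.trans_le hR
  -- the annulus part of the majorant
  set A : Set E := {ξ : E | R⁻¹ ≤ ‖ξ‖ ∧ ‖ξ‖ ≤ 1} with hA
  have hAm : MeasurableSet A :=
    (measurableSet_le measurable_const measurable_norm).inter (measurableSet_le measurable_norm measurable_const)
  set f : E → ℝ := fun ξ => ‖ξ‖ ^ (-((d : ℝ) + 1)) with hf
  have hfm : Measurable f := measurable_norm.pow_const _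
  have hf0 : ∀ ξ, 0 ≤ f ξ := fun ξ => Real.rpow_nonneg (norm_nonneg _) _
  have hAI : ∫⁻ ξ in A, ENNReal.ofReal (f ξ) ≤ ENNReal.ofReal (CE * R) := by
    have := lintegral_annulus_norm_rpow_neg_le (E := E) (inv_pos.2 hR0)
    rwa [div_inv_eq_mul] at this
  have hfA : IntegrableOn f A := by
    refine ⟨hfm.aestronglyMeasurable, ?_⟩
    rw [HasFiniteIntegral]
    calc ∫⁻ ξ in A, ‖f ξ‖ₑ = ∫⁻ ξ in A, ENNReal.ofReal (f ξ) := by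
          refine lintegral_congr fun ξ => ?_
          rw [← ofReal_norm, Real.norm_eq_abs, abs_of_nonneg (hf0 ξ)]
      _ ≤ ENNReal.ofReal (CE * R) := hAI
      _ < ⊤ := ENNReal.ofReal_lt_top
  have hfA_int : ∫ ξ in A, f ξ ≤ CE * R := by
    rw [integral_eq_lintegral_of_nonneg_ae (Eventually.of_forall fun ξ => hf0 ξ) hfm.aestronglyMeasurable]
    exact ENNReal.toReal_le_of_le_ofReal (by positivity) hAI
  -- the majorant
  set g : E → ℝ := fun ξ => B * (A.indicator f ξ + 2 * (‖ξ‖ ^ (k + n) * Real.exp (-a * ‖ξ‖ ^ 2))) with hg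
  have hgint : Integrable g :=
    ((hfA.integrable_indicator hAm).add (hIint.const_mul 2)).const_mul B
  have hg_bound : ∀ ξ : E, ‖iteratedFDeriv ℝ n (cutSymbol τ a R) ξ‖ ≤ g ξ := by
    intro ξ
    have hind0 : 0 ≤ A.indicator f ξ := Set.indicator_nonneg (fun x _ => hf0 x) ξ
    by_cases h1 : ‖R • ξ‖ < 1
    · rw [iteratedFDeriv_cutSymbol_eq_zero τ a h1, norm_zero]
      positivity
    · have hξ : ξ ≠ 0 := by rintro rfl; exact h1 (by simp)
      set t : ℝ := ‖ξ‖ with ht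
      have ht0 : 0 < t := norm_pos_iff.2 hξ
      have htR : R⁻¹ ≤ t := by
        rw [norm_smul, Real.norm_eq_abs, abs_of_pos hR0, not_lt] at h1
        rw [inv_le_iff_one_le_mul₀ hR0, mul_comm]; exact h1
      refine (hB R hR0 ξ hξ).trans ?_
      rw [hg]
      refine mul_le_mul_of_nonneg_left ?_ hB0
      have he1 : Real.exp (-a * t ^ 2) ≤ 1 := by
        rw [Real.exp_le_one_iff]; nlinarith [sq_nonneg t]
      have he0 : 0 < Real.exp (-a * t ^ 2) := Real.exp_pos _
      rcases le_or_gt t 1 with h2 | h2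
      · have hA1 : ξ ∈ A := ⟨htR, h2⟩
        rw [Set.indicator_of_mem hA1, hf]
        have h3 : t ^ ((k : ℝ) - n) ≤ t ^ (-((d : ℝ) + 1)) := by
          refine Real.rpow_le_rpow_of_exponent_ge ht0 h2 ?_
          have : (n : ℝ) ≤ k + d + 1 := by exact_mod_cast hn
          linarith
        calc (t ^ ((k : ℝ) - n) + t ^ (k + n)) * Real.exp (-a * t ^ 2)
            = t ^ ((k : ℝ) - n) * Real.exp (-a * t ^ 2) + t ^ (k + n) * Real.exp (-a * t ^ 2) := by ring
          _ ≤ t ^ (-((d : ℝ) + 1)) * 1 + 2 * (t ^ (k + n) * Real.exp (-a * t ^ 2)) := by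
              refine add_le_add (mul_le_mul h3 he1 he0.le (Real.rpow_nonneg ht0.le _)) ?_
              linarith [mul_nonneg (pow_nonneg ht0.le (k + n)) he0.le]
          _ = t ^ (-((d : ℝ) + 1)) + 2 * (t ^ (k + n) * Real.exp (-a * t ^ 2)) := by ring
      · have h3 : t ^ ((k : ℝ) - n) ≤ t ^ (k + n) := by
          rw [← Real.rpow_natCast t (k + n)]
          refine Real.rpow_le_rpow_of_exponent_le h2.le ?_
          push_cast; linarith
        calc (t ^ ((k : ℝ) - n) + t ^ (k + n)) * Real.exp (-a * t ^ 2)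
            ≤ (t ^ (k + n) + t ^ (k + n)) * Real.exp (-a * t ^ 2) := by gcongr
          _ = 0 + 2 * (t ^ (k + n) * Real.exp (-a * t ^ 2)) := by ring
          _ ≤ A.indicator f ξ + 2 * (t ^ (k + n) * Real.exp (-a * t ^ 2)) := by gcongr
  have hcont : Continuous (iteratedFDeriv ℝ n (cutSymbol τ a R)) :=
    (contDiff_cutSymbol hτ a R).continuous_iteratedFDeriv (mod_cast le_top)
  have hint : Integrable (iteratedFDeriv ℝ n (cutSymbol τ a R)) :=
    hgint.mono' hcont.aestronglyMeasurable (Eventually.of_forall hg_bound)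
  refine ⟨hint, ?_⟩
  calc ∫ ξ, ‖iteratedFDeriv ℝ n (cutSymbol τ a R) ξ‖ ≤ ∫ ξ, g ξ :=
        integral_mono hint.norm hgint hg_bound
    _ = B * ((∫ ξ in A, f ξ) + 2 * I) := by
        rw [hg, integral_const_mul, integral_add (hfA.integrable_indicator hAm) (hIint.const_mul 2),
          integral_indicator hAm, integral_const_mul]
    _ ≤ B * (CE * R + 2 * I * R) := by
        refine mul_le_mul_of_nonneg_left (add_le_add hfA_int ?_) hB0
        exact le_mul_of_one_le_right (by positivity) hR
    _ = B * (CE + 2 * I) * R := by ring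

/-! ### Fourier decay of the high-frequency part -/

/-- **High-frequency decay**: `‖𝓕⁻ b_{‖u‖}(u)‖ ≤ C ‖u‖^{-(k+d)}` for `‖u‖ ≥ 1`
(`N = k + d + 1` integrations by parts: `‖u‖^N ‖𝓕 b(−u)‖ ≤ 2^N Σ_{n≤N} ‖Dⁿ b‖_{L¹} ≤ C' ‖u‖`). [folklore] -/
theorem exists_norm_fourierInv_cutSymbol_le {τ : E → ℂ} {k : ℕ} (hτ : ContDiffOn ℝ ∞ τ {0}ᶜ)
    (hhom : ∀ c : ℝ, 0 < c → ∀ ξ : E, ξ ≠ 0 → τ (c • ξ) = (c : ℂ) ^ k * τ ξ) {a : ℝ} (ha : 0 < a) :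
    ∃ C : ℝ, 0 ≤ C ∧ ∀ u : E, 1 ≤ ‖u‖ →
      ‖𝓕⁻ (cutSymbol τ a ‖u‖) u‖ ≤ C / ‖u‖ ^ (k + finrank ℝ E) := by
  set d : ℕ := finrank ℝ E with hd
  set N : ℕ := k + d + 1 with hN
  have hex : ∀ n : ℕ, ∃ C : ℝ, 0 ≤ C ∧ (n ≤ N → ∀ R : ℝ, 1 ≤ R →
      Integrable (iteratedFDeriv ℝ n (cutSymbol τ a R)) ∧
        ∫ ξ, ‖iteratedFDeriv ℝ n (cutSymbol τ a R) ξ‖ ≤ C * R) := by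
    intro n
    by_cases hn : n ≤ N
    · obtain ⟨C, hC0, hC⟩ := exists_integral_norm_iteratedFDeriv_cutSymbol_le hτ hhom ha hn
      exact ⟨C, hC0, fun _ => hC⟩
    · exact ⟨0, le_rfl, fun h => absurd h hn⟩
  choose C hC0 hC using hex
  set S : ℝ := ∑ n ∈ Finset.range (N + 1), C n with hS
  have hS0 : 0 ≤ S := Finset.sum_nonneg fun n _ => hC0 n
  refine ⟨2 ^ N * S, by positivity, fun u hu => ?_⟩
  set R : ℝ := ‖u‖ with hR
  have hR0 : 0 < R := one_pos.trans_le hu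
  have hf : ContDiff ℝ N (cutSymbol τ a R) := (contDiff_cutSymbol hτ a R).of_le (mod_cast le_top)
  have h'f : ∀ (k' n : ℕ), (k' : ℕ∞) ≤ (0 : ℕ∞) → (n : ℕ∞) ≤ (N : ℕ∞) →
      Integrable (fun v : E => ‖v‖ ^ k' * ‖iteratedFDeriv ℝ n (cutSymbol τ a R) v‖) := by
    intro k' n hk' hn
    have hk0 : k' = 0 := by exact_mod_cast nonpos_iff_eq_zero.1 hk'
    have hnN : n ≤ N := by exact_mod_cast hn
    subst hk0
    simpa using (hC n hnN R hu).1.norm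
  have hmain := Real.pow_mul_norm_iteratedFDeriv_fourier_le (K := (0 : ℕ∞)) (N := (N : ℕ∞)) hf h'f
    (k := 0) (n := N) le_rfl le_rfl (-u)
  rw [norm_neg, norm_iteratedFDeriv_zero, ← Real.fourierInv_eq_fourier_neg] at hmain
  simp only [pow_zero, Nat.cast_zero, mul_zero, zero_add, one_mul, Finset.range_one] at hmain
  rw [Finset.sum_product, Finset.sum_singleton] at hmain
  simp only [pow_zero, one_mul] at hmain
  -- bound the sum of `L¹` norms
  have hsum : ∑ n ∈ Finset.range (N + 1), ∫ v, ‖iteratedFDeriv ℝ n (cutSymbol τ a R) v‖ ≤ S * R := by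
    rw [hS, Finset.sum_mul]
    refine Finset.sum_le_sum fun n hn => ?_
    exact (hC n (Nat.lt_succ_iff.1 (Finset.mem_range.1 hn)) R hu).2
  have h1 : R ^ N * ‖𝓕⁻ (cutSymbol τ a R) u‖ ≤ 2 ^ N * (S * R) :=
    hmain.trans (mul_le_mul_of_nonneg_left hsum (by positivity))
  rw [le_div_iff₀ (by positivity)]
  have hRN : R ^ N = R ^ (k + d) * R := by rw [hN, pow_succ]
  rw [hRN] at h1
  have h2 : (‖𝓕⁻ (cutSymbol τ a R) u‖ * R ^ (k + d)) * R ≤ (2 ^ N * S) * R := by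
    calc (‖𝓕⁻ (cutSymbol τ a R) u‖ * R ^ (k + d)) * R = R ^ (k + d) * R * ‖𝓕⁻ (cutSymbol τ a R) u‖ := by ring
      _ ≤ 2 ^ N * (S * R) := h1
      _ = (2 ^ N * S) * R := by ring
  exact le_of_mul_le_mul_right h2 hR0

/-! ### The low-frequency part and the decay theorem -/

omit [FiniteDimensional ℝ E] [MeasurableSpace E] [BorelSpace E] in
/-- Measurability of a symbol continuous off the origin. [folklore] -/
theorem measurable_of_contDiffOn_compl_zero [MeasurableSpace E] [BorelSpace E] {τ : E → ℂ} (hτ : ContDiffOn ℝ ∞ τ {0}ᶜ) :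
    Measurable τ :=
  measurable_of_continuousOn_compl_singleton 0 hτ.continuousOn

/-- **Low-frequency part**: `‖𝓕⁻[τ e^{-a‖·‖²} χ₀(‖u‖ ·)](u)‖ ≤ T₀ 2^{k+d} |B₁| ‖u‖^{-(k+d)}`
(the symbol is bounded by `T₀ (2/‖u‖)^k` on its support, the ball of radius `2/‖u‖`). [folklore] -/
theorem norm_fourierInv_lowSymbol_le {τ : E → ℂ} {k : ℕ} {T₀ : ℝ} (hT₀ : 0 ≤ T₀)
    (hτb : ∀ ξ : E, ξ ≠ 0 → ‖τ ξ‖ ≤ T₀ * ‖ξ‖ ^ k) (h0 : τ 0 = 0) {a : ℝ} (ha : 0 ≤ a)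
    {u : E} (hu : 0 < ‖u‖) :
    ‖𝓕⁻ (fun ξ => τ ξ * cgauss a ξ * (1 - highCutoff ‖u‖ ξ)) u‖ ≤
      T₀ * 2 ^ (k + finrank ℝ E) * (volume (ball (0 : E) 1)).toReal / ‖u‖ ^ (k + finrank ℝ E) := by
  set d : ℕ := finrank ℝ E with hd
  set R : ℝ := ‖u‖ with hR
  set g : E → ℂ := fun ξ => τ ξ * cgauss a ξ * (1 - highCutoff R ξ) with hg
  -- pointwise bound by an indicator
  set s : ℝ := 2 / R with hs
  have hs0 : 0 < s := by positivity
  have hbound : ∀ ξ : E, ‖g ξ‖ ≤ (closedBall (0 : E) s).indicator (fun _ => T₀ * s ^ k) ξ := by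
    intro ξ
    by_cases hξs : ξ ∈ closedBall (0 : E) s
    · rw [Set.indicator_of_mem hξs]
      rw [mem_closedBall, dist_zero_right] at hξs
      by_cases hξ : ξ = 0
      · simp only [hg, hξ, h0, zero_mul, norm_zero]; positivity
      · calc ‖g ξ‖ = ‖τ ξ‖ * ‖cgauss a ξ‖ * ‖1 - highCutoff R ξ‖ := by rw [hg]; simp only [norm_mul]
          _ ≤ T₀ * ‖ξ‖ ^ k * 1 * 1 :=
              mul_le_mul (mul_le_mul (hτb ξ hξ) (norm_cgauss_le_one ha ξ) (norm_nonneg _)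
                (mul_nonneg hT₀ (pow_nonneg (norm_nonneg _) _))) (norm_one_sub_highCutoff_le_one R ξ)
                (norm_nonneg _) (mul_nonneg (mul_nonneg hT₀ (pow_nonneg (norm_nonneg _) _)) zero_le_one)
          _ ≤ T₀ * s ^ k * 1 * 1 := by gcongr
          _ = T₀ * s ^ k := by ring
    · rw [Set.indicator_of_notMem hξs]
      rw [mem_closedBall, dist_zero_right, not_le] at hξs
      have h2 : 2 ≤ ‖R • ξ‖ := by
        rw [norm_smul, Real.norm_eq_abs, abs_of_pos hu]
        rw [hs, div_lt_iff₀ hu] at hξs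
        linarith
      simp only [hg, highCutoff_of_le_norm h2, sub_self, mul_zero, norm_zero, le_rfl]
  have hvol : volume (closedBall (0 : E) s) < ⊤ := measure_closedBall_lt_top
  have hind : Integrable ((closedBall (0 : E) s).indicator (fun _ : E => T₀ * s ^ k)) :=
    (integrableOn_const hvol.ne).integrable_indicator measurableSet_closedBall
  calc ‖𝓕⁻ g u‖ ≤ ∫ ξ, ‖g ξ‖ := by
        rw [show 𝓕⁻ g u = VectorFourier.fourierIntegral 𝐞 volume (-innerₗ E) g u from rfl]
        exact VectorFourier.norm_fourierIntegral_le_integral_norm _ _ _ _ _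
    _ ≤ ∫ ξ, (closedBall (0 : E) s).indicator (fun _ => T₀ * s ^ k) ξ := by
        refine integral_mono_of_nonneg (Eventually.of_forall fun ξ => norm_nonneg _) hind
          (Eventually.of_forall hbound)
    _ = T₀ * s ^ k * (volume.real (closedBall (0 : E) s)) := by
        rw [integral_indicator measurableSet_closedBall, setIntegral_const, smul_eq_mul, mul_comm]
    _ = T₀ * s ^ k * (s ^ d * (volume (ball (0 : E) 1)).toReal) := by
        rw [Measure.addHaar_real_closedBall _ _ hs0.le]
        rfl
    _ = T₀ * 2 ^ (k + d) * (volume (ball (0 : E) 1)).toReal / R ^ (k + d) := by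
        rw [hs, div_pow, div_pow, pow_add, pow_add]
        field_simp

omit [FiniteDimensional ℝ E] [MeasurableSpace E] [BorelSpace E] in
/-- Pointwise bound of the low-frequency part by an indicator. [folklore] -/
theorem norm_lowSymbol_le_indicator {τ : E → ℂ} {k : ℕ} {T₀ : ℝ} (hT₀ : 0 ≤ T₀)
    (hτb : ∀ ξ : E, ξ ≠ 0 → ‖τ ξ‖ ≤ T₀ * ‖ξ‖ ^ k) (h0 : τ 0 = 0) {a : ℝ} (ha : 0 ≤ a)
    {R : ℝ} (hR : 0 < R) (ξ : E) :
    ‖τ ξ * cgauss a ξ * (1 - highCutoff R ξ)‖ ≤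
      (closedBall (0 : E) (2 / R)).indicator (fun _ => T₀ * (2 / R) ^ k) ξ := by
  set s : ℝ := 2 / R with hs
  by_cases hξs : ξ ∈ closedBall (0 : E) s
  · rw [Set.indicator_of_mem hξs]
    rw [mem_closedBall, dist_zero_right] at hξs
    by_cases hξ : ξ = 0
    · simp only [hξ, h0, zero_mul, norm_zero]; positivity
    · calc ‖τ ξ * cgauss a ξ * (1 - highCutoff R ξ)‖ = ‖τ ξ‖ * ‖cgauss a ξ‖ * ‖1 - highCutoff R ξ‖ := by
            simp only [norm_mul]
        _ ≤ T₀ * ‖ξ‖ ^ k * 1 * 1 :=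
            mul_le_mul (mul_le_mul (hτb ξ hξ) (norm_cgauss_le_one ha ξ) (norm_nonneg _)
              (mul_nonneg hT₀ (pow_nonneg (norm_nonneg _) _))) (norm_one_sub_highCutoff_le_one R ξ)
              (norm_nonneg _) (mul_nonneg (mul_nonneg hT₀ (pow_nonneg (norm_nonneg _) _)) zero_le_one)
        _ ≤ T₀ * s ^ k * 1 * 1 := by gcongr
        _ = T₀ * s ^ k := by ring
  · rw [Set.indicator_of_notMem hξs]
    rw [mem_closedBall, dist_zero_right, not_le] at hξs
    have h2 : 2 ≤ ‖R • ξ‖ := by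
      rw [norm_smul, Real.norm_eq_abs, abs_of_pos hR]
      rw [hs, div_lt_iff₀ hR] at hξs
      linarith
    simp only [highCutoff_of_le_norm h2, sub_self, mul_zero, norm_zero, le_rfl]

/-- Integrability of the low-frequency part. [folklore] -/
theorem integrable_lowSymbol {τ : E → ℂ} {k : ℕ} {T₀ : ℝ} (hT₀ : 0 ≤ T₀) (hτ : ContDiffOn ℝ ∞ τ {0}ᶜ)
    (hτb : ∀ ξ : E, ξ ≠ 0 → ‖τ ξ‖ ≤ T₀ * ‖ξ‖ ^ k) (h0 : τ 0 = 0) {a : ℝ} (ha : 0 ≤ a)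
    {R : ℝ} (hR : 0 < R) :
    Integrable (fun ξ : E => τ ξ * cgauss a ξ * (1 - highCutoff R ξ)) := by
  have hvol : volume (closedBall (0 : E) (2 / R)) < ⊤ := measure_closedBall_lt_top
  have hind : Integrable ((closedBall (0 : E) (2 / R)).indicator (fun _ : E => T₀ * (2 / R) ^ k)) :=
    (integrableOn_const hvol.ne).integrable_indicator measurableSet_closedBall
  refine hind.mono' ?_ (Eventually.of_forall (norm_lowSymbol_le_indicator hT₀ hτb h0 ha hR))
  have hm : Measurable τ := measurable_of_contDiffOn_compl_zero hτ
  exact ((hm.mul (contDiff_cgauss a (n := 0)).continuous.measurable).mul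
    (continuous_const.sub (contDiff_highCutoff R (n := 0)).continuous).measurable).aestronglyMeasurable

/-- Integrability of the full symbol `τ e^{-a‖·‖²}`. [folklore] -/
theorem integrable_homogeneous_mul_cgauss {τ : E → ℂ} {k : ℕ} {T₀ : ℝ} (hT₀ : 0 ≤ T₀)
    (hτ : ContDiffOn ℝ ∞ τ {0}ᶜ)
    (hτb : ∀ ξ : E, ξ ≠ 0 → ‖τ ξ‖ ≤ T₀ * ‖ξ‖ ^ k) (h0 : τ 0 = 0) {a : ℝ} (ha : 0 < a) :
    Integrable (fun ξ : E => τ ξ * cgauss a ξ) := by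
  have hmaj : Integrable (fun ξ : E => T₀ * (‖ξ‖ ^ k * Real.exp (-a * ‖ξ‖ ^ 2))) :=
    (integrable_norm_pow_mul_exp_neg_mul_norm_sq ha k).const_mul T₀
  refine hmaj.mono' ?_ (Eventually.of_forall fun ξ => ?_)
  · have hm : Measurable τ := measurable_of_contDiffOn_compl_zero hτ
    exact (hm.mul (contDiff_cgauss a (n := 0)).continuous.measurable).aestronglyMeasurable
  · by_cases hξ : ξ = 0
    · simp only [hξ, h0, zero_mul, norm_zero]
      positivity
    · rw [norm_mul, norm_cgauss]
      calc ‖τ ξ‖ * Real.exp (-a * ‖ξ‖ ^ 2) ≤ T₀ * ‖ξ‖ ^ k * Real.exp (-a * ‖ξ‖ ^ 2) := by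
            gcongr; exact hτb ξ hξ
        _ = T₀ * (‖ξ‖ ^ k * Real.exp (-a * ‖ξ‖ ^ 2)) := by ring

omit [MeasurableSpace E] [BorelSpace E] in
/-- `(1 + R)ᵖ ≤ 2ᵖ Rᵖ` for `R ≥ 1`. [folklore] -/
theorem one_add_pow_le_two_pow_mul_pow {R : ℝ} (hR : 1 ≤ R) (p : ℕ) : (1 + R) ^ p ≤ 2 ^ p * R ^ p := by
  rw [← mul_pow]; exact pow_le_pow_left₀ (by linarith) (by linarith) p

/-- **Decay of the inverse Fourier transform of a homogeneous symbol times a Gaussian.** Let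
`τ ∈ C^∞(E ∖ {0})` be positively homogeneous of degree `k ∈ ℕ` (`τ(cξ) = cᵏ τ(ξ)`, `c > 0`,
`ξ ≠ 0`; `τ(0) = 0`) and `a > 0`. Then `K = 𝓕⁻(τ e^{-a‖·‖²})` satisfies
`|K(u)| (1 + ‖u‖)^{k+d} ≤ C` (`d = dim E`): for `‖u‖ ≥ 1` split the symbol with the cutoff
`χ₀(‖u‖ξ)`; the low-frequency part has `L¹` norm `≲ ‖u‖^{-(k+d)}`, and `k + d + 1` integrations by
parts bound the high-frequency part by `‖u‖^{-(k+d+1)} Σₙ ‖Dⁿ b‖_{L¹} ≲ ‖u‖^{-(k+d)}`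
(the estimate quoted in Lemarié-Rieusset 2016, proof of Prop. 13.4, p. 465, for `k = 1, 2, 3`,
`d = 3`; Stein 1993, Ch. VI §4, kernel estimates for symbols of order `k`). The hypothesis
`h0 : τ 0 = 0` is mathematically superfluous when `dim E ≥ 1` (`𝓕⁻` ignores a point) and is implied
by homogeneity over all `ξ` when `k ≥ 1` (as in the consumer `prop13_4`); it is used only through
the integrability lemmas `integrable_lowSymbol` / `integrable_homogeneous_mul_cgauss`.
[cite: Stein1993, Ch. VI §4] -/
theorem exists_norm_fourierInv_homogeneous_mul_cgauss_le {τ : E → ℂ} {k : ℕ}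
    (hτ : ContDiffOn ℝ ∞ τ {0}ᶜ)
    (hhom : ∀ c : ℝ, 0 < c → ∀ ξ : E, ξ ≠ 0 → τ (c • ξ) = (c : ℂ) ^ k * τ ξ) (h0 : τ 0 = 0)
    {a : ℝ} (ha : 0 < a) :
    ∃ C : ℝ, ∀ u : E,
      ‖𝓕⁻ (fun ξ => τ ξ * cgauss a ξ) u‖ * (1 + ‖u‖) ^ (k + finrank ℝ E) ≤ C := by
  set d : ℕ := finrank ℝ E with hd
  -- order-zero bound of the symbol
  obtain ⟨T₀, hT₀, hT⟩ := exists_norm_iteratedFDeriv_homogeneous_le hτ hhom 0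
  have hτb : ∀ ξ : E, ξ ≠ 0 → ‖τ ξ‖ ≤ T₀ * ‖ξ‖ ^ k := fun ξ hξ => norm_homogeneous_le hT hξ
  set m : E → ℂ := fun ξ => τ ξ * cgauss a ξ with hm
  have hmint : Integrable m := integrable_homogeneous_mul_cgauss hT₀ hτ hτb h0 ha
  set I₀ : ℝ := ∫ ξ, ‖m ξ‖ with hI₀
  have hI₀0 : 0 ≤ I₀ := integral_nonneg fun ξ => norm_nonneg _
  have hK0 : ∀ u : E, ‖𝓕⁻ m u‖ ≤ I₀ := fun u => by
    rw [show 𝓕⁻ m u = VectorFourier.fourierIntegral 𝐞 volume (-innerₗ E) m u from rfl]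
    exact VectorFourier.norm_fourierIntegral_le_integral_norm _ _ _ _ _
  -- the two parts
  obtain ⟨Ch, hCh0, hCh⟩ := exists_norm_fourierInv_cutSymbol_le hτ hhom ha
  set V : ℝ := (volume (ball (0 : E) 1)).toReal with hV
  have hV0 : 0 ≤ V := ENNReal.toReal_nonneg
  set Cl : ℝ := T₀ * 2 ^ (k + d) * V with hCl
  refine ⟨2 ^ (k + d) * (Cl + Ch + I₀), fun u => ?_⟩
  rcases lt_or_ge ‖u‖ 1 with hu | hu
  · -- small `u`
    calc ‖𝓕⁻ m u‖ * (1 + ‖u‖) ^ (k + d) ≤ I₀ * 2 ^ (k + d) := by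
          refine mul_le_mul (hK0 u) (pow_le_pow_left₀ (by positivity) (by linarith) _) (by positivity) hI₀0
      _ ≤ 2 ^ (k + d) * (Cl + Ch + I₀) := by
          rw [mul_comm]; gcongr; linarith [mul_nonneg hT₀ (by positivity : (0 : ℝ) ≤ 2 ^ (k + d) * V)]
  · -- large `u`: split
    set R : ℝ := ‖u‖ with hR
    have hR0 : 0 < R := one_pos.trans_le hu
    set g : E → ℂ := fun ξ => τ ξ * cgauss a ξ * (1 - highCutoff R ξ) with hg
    have hgint : Integrable g := integrable_lowSymbol hT₀ hτ hτb h0 ha.le hR0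
    have hbint : Integrable (cutSymbol τ a R) := by
      obtain ⟨C0, -, hC0⟩ := exists_integral_norm_iteratedFDeriv_cutSymbol_le hτ hhom ha
        (n := 0) (Nat.zero_le _)
      have h := (hC0 R hu).1
      refine h.norm.mono' (contDiff_cutSymbol hτ a R).continuous.aestronglyMeasurable
        (Eventually.of_forall fun ξ => ?_)
      rw [norm_iteratedFDeriv_zero]
    have hsplit : m = g + cutSymbol τ a R := by
      funext ξ
      simp only [hm, hg, cutSymbol, Pi.add_apply]
      ring
    have hadd : 𝓕⁻ m u = 𝓕⁻ g u + 𝓕⁻ (cutSymbol τ a R) u := by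
      rw [hsplit]
      change VectorFourier.fourierIntegral 𝐞 volume (-innerₗ E) (g + cutSymbol τ a R) u = _
      have hL : Continuous fun p : E × E => (-innerₗ E) p.1 p.2 := by
        simp only [LinearMap.neg_apply, innerₗ_apply_apply]
        exact continuous_inner.neg
      rw [VectorFourier.fourierIntegral_add Real.continuous_fourierChar hL hgint hbint]
      rfl
    have hlow : ‖𝓕⁻ g u‖ ≤ Cl / R ^ (k + d) := norm_fourierInv_lowSymbol_le hT₀ hτb h0 ha.le hR0
    have hhigh : ‖𝓕⁻ (cutSymbol τ a R) u‖ ≤ Ch / R ^ (k + d) := hCh u hu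
    have hRp : 0 < R ^ (k + d) := by positivity
    calc ‖𝓕⁻ m u‖ * (1 + R) ^ (k + d)
        ≤ (Cl / R ^ (k + d) + Ch / R ^ (k + d)) * (2 ^ (k + d) * R ^ (k + d)) := by
          refine mul_le_mul ?_ (one_add_pow_le_two_pow_mul_pow hu _) (by positivity) (by positivity)
          rw [hadd]
          exact (norm_add_le _ _).trans (add_le_add hlow hhigh)
      _ = 2 ^ (k + d) * (Cl + Ch) := by field_simp
      _ ≤ 2 ^ (k + d) * (Cl + Ch + I₀) :=
          mul_le_mul_of_nonneg_left (le_add_of_nonneg_right hI₀0) (by positivity)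

end L1

end Literature.Analysis.Fourier
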